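import Literature.Computability.AlgebraicComplexity.NoncommutativeCircuits
import Mathlib.Analysis.SpecialFunctions.Pow.Real
import HarnessLib

/-!
# The sum-of-squares problem and noncommutative circuits for the permanent
# (Hrubeš–Wigderson–Yehudayoff 2010, §1.2–1.3, Theorem 1.7)

Topic: `Literature/Computability/AlgebraicComplexity`. Statement file: HWY's bilinear complexity
`B_F(f)` of a biquadratic polynomial, the sum-of-squares polynomial `SOS_k`, and ONE named fact,
Theorem 1.7 (held text `paper:doi-10-1145-1806689-1806781`, p.5):

> bilinear complexity: `B_F(f)` is the smallest `n` so that `f` can be written as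
> `f = z_1 z'_1 + ⋯ + z_n z'_n`, where each `z_i` and `z'_i` are bilinear forms in `X, Y`.
> **Theorem 1.7.** Assume that `B_F(SOS_k) ≥ Ω(k^{1+ε})` for some `ε > 0`. Then `PERM_n` requires
> non-commutative circuits of size `2^{Ω(n)}`.

with `SOS_k = (∑_{i∈[k]} x_i²)·(∑_{i∈[k]} y_i²)` (§1.2, (1.1)) and `PERM_n(X) = ∑_π x_{1,π(1)} ⋯ x_{n,π(n)}`
(p.4, row-ordered). Context (p.5–6): `k ≤ B_F(SOS_k) ≤ S_F(SOS_k) ≤ O(k²/log k)`; Remark 1.5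
`S_F ≤ 3 B_F` over algebraically closed `F` of characteristic `≠ 2`, whence Thm 1.4; Thm 1.8 (any
explicit biquadratic family in place of `SOS_k`, `char F ≠ 2`); Thm 1.10 `S_ℤ(k) ≥ Ω(k^{6/5})` over
the INTEGERS, which "does not imply a circuit lower bound". The theorem is proved in HWY10 §C for
every field `F`.

Rendering. `HWY10.bilinearComplexity F f` is an `sInf` over `ℕ` (junk value `0` when `f` admits no
such expression, i.e. is not biquadratic; `SOS_k` is biquadratic, `B(SOS_k) ≤ k²`). The hypothesis
"`B_F(SOS_k) ≥ Ω(k^{1+ε})` for some `ε > 0`" is `∃ ε > 0, ∃ c > 0, ∀ k, c·k^{1+ε} ≤ B_F(SOS_k)` (real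
exponent). The conclusion "`PERM_n` requires non-commutative circuits of size `2^{Ω(n)}`" is rendered
in the tree's circuit model (`NoncommutativeCircuits.lean`: fan-in-two `ArithCircuit` read in the free
algebra, size = number of gates, column-ordered `ncPerPoly` — equivalent to HWY's row-ordered `PERM_n`
under the size-preserving renaming `x_{ij} ↦ x_{ji}`, and to HWY's node/edge count up to a constant
factor) discretely as `∃ d n₀, ∀ n ≥ n₀, ∀ s, HasNcCircuitSizeLE (ncPerPoly F n) s → 2^n ≤ (s+1)^d`
(`size ≥ 2^{n/d} - 1` eventually ⟺ size `2^{Ω(n)}`). Statement only (named fact, no discharge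
attempted: the proof is HWY10 §A–§C, some fifteen pages). No instances, no notation.

USE. Summit-side (`Summits/ValiantsHypothesis/…/Theorems/NcSOSRoad.lean`) the fact turns the numeric
conjecture `B_ℂ(SOS_k) ≥ Ω(k^{1+ε})` into the dial piece `A_nc` ("the permanent has no polynomial-size
noncommutative circuits"), a necessary condition for `VP ≠ VNP`.

## References

* [HrubesWigdersonYehudayoff2010] P. Hrubeš, A. Wigderson, A. Yehudayoff, *Non-commutative circuits and
  the sum-of-squares problem*, STOC 2010, 667–676; J. Amer. Math. Soc. 24 (2011) 871–898 — §1.2 (1.1),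
  §1.3 (bilinear complexity, Thm 1.4, Rem 1.5, Thm 1.6, Thm 1.7, Thm 1.8), Thm 1.10, §C (proof).
-/

noncomputable section

open MvPolynomial

namespace Literature.Computability.AlgebraicComplexity

universe u

namespace HWY10

variable (F : Type u) [CommRing F]

/-- The bilinear form `∑_{i,j} a_{ij} x_i y_j` in the variables `X = inl`, `Y = inr` (HWY10 §1.3).
[cite: HrubesWigdersonYehudayoff2010, §1.3] -/
def bilinForm {k : ℕ} (a : Fin k → Fin k → F) : MvPolynomial (Fin k ⊕ Fin k) F :=
  ∑ i : Fin k, ∑ j : Fin k, a i j • (X (Sum.inl i) * X (Sum.inr j))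

/-- HWY's BILINEAR COMPLEXITY `B_F(f)`: the least `m` such that `f = ∑_{l<m} z_l · z'_l` with every
`z_l`, `z'_l` a bilinear form in `X, Y` (`sInf` over `ℕ`; junk `0` when `f` is not biquadratic).
[cite: HrubesWigdersonYehudayoff2010, §1.3] -/
def bilinearComplexity {k : ℕ} (f : MvPolynomial (Fin k ⊕ Fin k) F) : ℕ :=
  sInf {m : ℕ | ∃ a b : Fin m → Fin k → Fin k → F,
    f = ∑ l : Fin m, bilinForm F (a l) * bilinForm F (b l)}

/-- The sum-of-squares polynomial `SOS_k = (x_1² + ⋯ + x_k²)·(y_1² + ⋯ + y_k²)` (HWY10 (1.1)).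
[cite: HrubesWigdersonYehudayoff2010, §1.2 (1.1)] -/
def sosPoly (k : ℕ) : MvPolynomial (Fin k ⊕ Fin k) F :=
  (∑ i : Fin k, X (Sum.inl i) ^ 2) * (∑ j : Fin k, X (Sum.inr j) ^ 2)

/-- The hypothesis of Thm 1.7 as a closed statement: `B_F(SOS_k) ≥ Ω(k^{1+ε})` for some `ε > 0`
(OPEN over `ℂ`; HWY10 p.5–6). [cite: HrubesWigdersonYehudayoff2010, Thm 1.7 (hypothesis)] -/
def SOSBilinearSuperlinear : Prop :=
  ∃ ε : ℝ, 0 < ε ∧ ∃ c : ℝ, 0 < c ∧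
    ∀ k : ℕ, c * (k : ℝ) ^ (1 + ε) ≤ (bilinearComplexity F (sosPoly F k) : ℝ)

/-- The conclusion of Thm 1.7 as a closed statement: the ordered permanent requires noncommutative
circuits of size `2^{Ω(n)}` — `2^n ≤ (s+1)^d` for every size-`s` fan-in-two circuit, all `n ≥ n₀`
(OPEN). [cite: HrubesWigdersonYehudayoff2010, Thm 1.7 (conclusion)] -/
def PermNcExpHard : Prop :=
  ∃ d n₀ : ℕ, ∀ n : ℕ, n₀ ≤ n → ∀ s : ℕ, HasNcCircuitSizeLE (ncPerPoly F n) s → 2 ^ n ≤ (s + 1) ^ d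

end HWY10

/-- **Hrubeš–Wigderson–Yehudayoff 2010, Theorem 1.7** ("Assume that `B_F(SOS_k) ≥ Ω(k^{1+ε})` for
some `ε > 0`. Then `PERM_n` requires non-commutative circuits of size `2^{Ω(n)}`"), over the field `F`,
rendered as `HWY10.SOSBilinearSuperlinear F → HWY10.PermNcExpHard F` in the tree's circuit model (see
the module docstring for the faithfulness of the rendering). Named fact, used as a hypothesis.
[cite: HrubesWigdersonYehudayoff2010, Thm 1.7 (p.5; proof §C)] [status: theorem in print, not formalised] -/
def HWY10_thm_1_7 (F : Type u) [Field F] : Prop :=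
  HWY10.SOSBilinearSuperlinear F → HWY10.PermNcExpHard F

end Literature.Computability.AlgebraicComplexity

end
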